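import Literature.Probability.RandomPlanarGeometry.SAWTriangularLoopKesten
import Literature.Probability.RandomPlanarGeometry.SAWTriangularEndpointMonotone
import Literature.Probability.RandomPlanarGeometry.SAWRatioLimitStepOne
import Mathlib.Analysis.SpecialFunctions.Pow.Asymptotics
import HarnessLib

/-!
# The one-step ratio limit theorem for self-avoiding polygons of the triangular lattice («TRI-SAP-RATIO», limit part)

Topic `Literature/Probability/RandomPlanarGeometry` (lane «pcv-sawmu», route R82; continues `SAWTriangularLoopKesten.lean`).
Sources: N. Madras, G. Slade, *The Self-Avoiding Walk* (1993), Lemma 7.3.1 p. 242 (Kesten's ratio lemma: root limit (i),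
ratio floor (ii), Kesten's inequality (iii) ⇒ ratio limit), Theorem 7.4.5 (c) p. 254 (`c_{N+2}(0,x)/c_N(0,x) → μ²` on `ℤ^d`,
Kesten 1963 / Madras 1988; `x = e` is the polygon case by (3.2.1)); the `𝕋` one-step statement is not in print.

For the rooted oriented polygon counts `ℓ_M = #loopSL M` (`= t_{M+1}`, R81/R82 tokens) the three hypotheses of the lane's
ONE-step Kesten lemma `Zd.tendsto_ratio_of_kesten_one` are: (iii) = K82 (`loopKesten_of`); (ii) `ℓ_M ≤ 4 ℓ_{M+1}` eventually —
loops are the fixed-endpoint walks to the six neighbours of `0`, and a-p1's «TRI-ENDPOINT-MONO» `exists_card_triSLx_le_four_mul`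
(M–S Lemma 7.3.3 on `𝕋`, one-step, constant 4) applies endpoint by endpoint; (i) the root limit `ℓ_M^{1/M} → μ(𝕋)` from the
log envelope of the «TRI-SAP» theorem (R81, a-p3: `|log t_N − N log μ(𝕋)| ≤ (53 + 3 log μ)√N`, here a HYPOTHESIS in that shape).
Hence **`t_{N+1}/t_N → μ(𝕋)`** and **`q_{N+1}(𝕋)/q_N(𝕋) = N t_{N+1}/((N+1) t_N) → μ(𝕋)`**, modulo the R81 envelope. (The mixed
RATE needs in addition polygon concatenation `t_n t_m ≤ Z m t_{n+m}` — face `TriSAPSuper`, not this file.)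

## Contents (namespace `Literature.Probability.RandomPlanarGeometry.SAW`; all PROVED, axioms standard)

* `card_loopSL_eq_sum` (partition by endpoint), **`exists_card_loopSL_le_four_mul`** (`ℓ_M ≤ 4 ℓ_{M+1}` eventually);
* `tendsto_rpow_of_logEnvelope` (abstract: `|log a_n − nL| ≤ c√n + C ⇒ a_n^{1/n} → e^L`);
* **`tendsto_loop_ratio_of_logEnvelope`**: the R81 log envelope ⇒ `ℓ_{M+1}/ℓ_M → μ(𝕋)`;
* **`triLoopRatio_of_logEnvelope`**, **`triSAPRatio_of_logEnvelope`**: the faces `TriLoopRatio` / `TriSAPRatio` of R82 in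
  brick-frame tokens, modulo the R81 envelope.
-/

noncomputable section

open Finset Filter Topology Literature.Probability.LatticeModels Literature.Probability.Percolation SimpleGraph
open scoped BigOperators

namespace Literature.Probability.RandomPlanarGeometry.SAW

/-! ### (ii) Loops are fixed-endpoint walks to the neighbours of `0`: `ℓ_M ≤ 4 ℓ_{M+1}` eventually -/

/-- Partition of the loops by their last vertex (a neighbour of `0`). [cite: MadrasSlade1993, §3.2 (3.2.1)] -/
theorem card_loopSL_eq_sum (M : ℕ) :
    #(loopSL M) = ∑ x ∈ triGraph.neighborFinset (0 : Site 2), #(triSLx M x) := by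
  classical
  rw [Finset.card_eq_sum_card_fiberwise (f := fun ω : List (Site 2) => ω.getD M 0)
    (t := triGraph.neighborFinset (0 : Site 2)) (fun ω hω => by
      have hω' : ω ∈ loopSL M := Finset.mem_coe.1 hω
      simp only [Finset.mem_coe, SimpleGraph.mem_neighborFinset]
      exact ((mem_loopSL.1 hω').2).symm)]
  refine Finset.sum_congr rfl fun x hx => ?_
  rw [SimpleGraph.mem_neighborFinset] at hx
  congr 1
  ext ω
  simp only [Finset.mem_filter, mem_loopSL, mem_triSLx]
  constructor
  · rintro ⟨⟨h1, -⟩, h2⟩; exact ⟨h1, h2⟩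
  · rintro ⟨h1, h2⟩; exact ⟨⟨h1, by rw [h2]; exact hx.symm⟩, h2⟩

/-- **`ℓ_M ≤ 4 ℓ_{M+1}` for `M ≥ M₀`** (hypothesis (ii) of Lemma 7.3.1 for loops): a-p1's one-step endpoint monotonicity
`#S_N(x) ≤ 4 #S_{N+1}(x)` (M–S Lemma 7.3.3 on `𝕋`) summed over the six neighbours `x` of `0`.
[cite: MadrasSlade1993, Lemma 7.3.3, p. 247] -/
theorem exists_card_loopSL_le_four_mul : ∃ M₀ : ℕ, ∀ M : ℕ, M₀ ≤ M → #(loopSL M) ≤ 4 * #(loopSL (M + 1)) := by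
  classical
  choose N₀ hN₀ using fun x : Site 2 => exists_card_triSLx_le_four_mul x
  refine ⟨(triGraph.neighborFinset (0 : Site 2)).sup N₀, fun M hM => ?_⟩
  rw [card_loopSL_eq_sum, card_loopSL_eq_sum, Finset.mul_sum]
  exact Finset.sum_le_sum fun x hx => hN₀ x M (le_trans (Finset.le_sup hx) hM)

/-! ### (i) The root limit from a log envelope -/

/-- `|log a_n − n·L| ≤ c√n + C` for all `n` (with `a_n > 0`) implies `a_n^{1/n} → e^L`.
[cite: MadrasSlade1993, Lemma 7.3.1 (i)] -/
theorem tendsto_rpow_of_logEnvelope {a : ℕ → ℝ} {L c C : ℝ} (ha : ∀ n, 0 < a n) (hc : 0 ≤ c)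
    (h : ∀ n : ℕ, |Real.log (a n) - n * L| ≤ c * Real.sqrt n + C) :
    Tendsto (fun n : ℕ => a n ^ (1 / (n : ℝ))) atTop (𝓝 (Real.exp L)) := by
  -- `a_n^{1/n} = exp (log a_n / n)` and `|log a_n / n − L| ≤ c/√n + C/n → 0`
  have hg : Tendsto (fun n : ℕ => c * (Real.sqrt n)⁻¹ + C * (n : ℝ)⁻¹) atTop (𝓝 0) := by
    have h1 : Tendsto (fun n : ℕ => (Real.sqrt n)⁻¹) atTop (𝓝 0) := by
      have := (tendsto_rpow_neg_atTop (by norm_num : (0 : ℝ) < 1 / 2)).comp tendsto_natCast_atTop_atTop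
      refine this.congr' (Eventually.of_forall fun n => ?_)
      simp only [Function.comp_apply]
      rw [Real.sqrt_eq_rpow, ← Real.rpow_neg (Nat.cast_nonneg n)]
    have h2 : Tendsto (fun n : ℕ => (n : ℝ)⁻¹) atTop (𝓝 0) := tendsto_inv_atTop_zero.comp tendsto_natCast_atTop_atTop
    simpa using (h1.const_mul c).add (h2.const_mul C)
  have hlog : Tendsto (fun n : ℕ => Real.log (a n) / n) atTop (𝓝 L) := by
    have hlo : Tendsto (fun n : ℕ => L - (c * (Real.sqrt n)⁻¹ + C * (n : ℝ)⁻¹)) atTop (𝓝 L) := by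
      simpa using (tendsto_const_nhds (x := L)).sub hg
    have hhi : Tendsto (fun n : ℕ => L + (c * (Real.sqrt n)⁻¹ + C * (n : ℝ)⁻¹)) atTop (𝓝 L) := by
      simpa using (tendsto_const_nhds (x := L)).add hg
    refine tendsto_of_tendsto_of_tendsto_of_le_of_le' hlo hhi ?_ ?_
    · filter_upwards [eventually_ge_atTop 1] with n hn
      have hn0 : (0 : ℝ) < n := by exact_mod_cast hn
      have hs0 : 0 < Real.sqrt n := Real.sqrt_pos.2 hn0
      have hb := (abs_le.1 (h n)).1
      rw [le_div_iff₀ hn0]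
      have e : (L - (c * (Real.sqrt n)⁻¹ + C * (n : ℝ)⁻¹)) * n = n * L - (c * Real.sqrt n + C) := by
        have hsn : Real.sqrt n * Real.sqrt n = n := Real.mul_self_sqrt hn0.le
        field_simp
        nlinarith [hsn]
      rw [e]; linarith
    · filter_upwards [eventually_ge_atTop 1] with n hn
      have hn0 : (0 : ℝ) < n := by exact_mod_cast hn
      have hs0 : 0 < Real.sqrt n := Real.sqrt_pos.2 hn0
      have hb := (abs_le.1 (h n)).2
      rw [div_le_iff₀ hn0]
      have e : (L + (c * (Real.sqrt n)⁻¹ + C * (n : ℝ)⁻¹)) * n = n * L + (c * Real.sqrt n + C) := by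
        have hsn : Real.sqrt n * Real.sqrt n = n := Real.mul_self_sqrt hn0.le
        field_simp
        nlinarith [hsn]
      rw [e]; linarith
  have hexp := (Real.continuous_exp.tendsto L).comp hlog
  refine hexp.congr' ?_
  filter_upwards [eventually_gt_atTop 0] with n hn
  simp only [Function.comp_apply]
  rw [Real.rpow_def_of_pos (ha n), one_div, ← div_eq_mul_inv]

/-! ### The ratio limit for loops -/

/-- **`ℓ_{M+1}/ℓ_M → μ(𝕋)`** (`ℓ_M = #loopSL M`), modulo the R81 log envelope in its face shape on `t_N = ℓ_{N−1}`:
Kesten's one-step ratio lemma `Zd.tendsto_ratio_of_kesten_one` with (i) the root limit from the envelope, (ii)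
`ℓ_M ≤ 4 ℓ_{M+1}`, (iii) K82. [cite: MadrasSlade1993, Lemma 7.3.1 and Theorem 7.4.5 (c)] -/
theorem tendsto_loop_ratio_of_logEnvelope
    (hEnv : ∀ N : ℕ, 4 ≤ N → (0 : ℝ) < #(loopSL (N - 1)) ∧
      |Real.log (#(loopSL (N - 1)) : ℝ) - N * logMuTri| ≤ (53 + 3 * logMuTri) * Real.sqrt N) :
    Tendsto (fun M : ℕ => (#(loopSL (M + 1)) : ℝ) / #(loopSL M)) atTop (𝓝 (Real.exp logMuTri)) := by
  have h5 : (0 : ℝ) ≤ Real.log (1 + Real.sqrt 5) :=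
    Real.log_nonneg (by have := Real.sqrt_nonneg 5; linarith)
  have hL : 0 ≤ logMuTri := h5.trans log_one_add_sqrt_five_le_logMuTri
  set c : ℝ := 53 + 3 * logMuTri with hcdef
  have hc : 0 ≤ c := by rw [hcdef]; linarith
  -- shift by `K ≥ 3 ∨ M₀` so that everything holds for all `n`
  obtain ⟨M₀, hM₀⟩ := exists_card_loopSL_le_four_mul
  set K : ℕ := max M₀ 3 with hK
  set a : ℕ → ℝ := fun n => (#(loopSL (n + K)) : ℝ) with ha
  have hpos : ∀ n, 0 < a n := fun n => by
    have h := (hEnv (n + K + 1) (by omega)).1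
    rwa [show n + K + 1 - 1 = n + K by omega] at h
  -- (i) root limit
  have hlim : Tendsto (fun n : ℕ => a n ^ (1 / (n : ℝ))) atTop (𝓝 (Real.exp logMuTri)) := by
    refine tendsto_rpow_of_logEnvelope hpos hc (C := c * ((K : ℝ) + 1) + ((K : ℝ) + 1) * logMuTri) ?_
    intro n
    have h := (hEnv (n + K + 1) (by omega)).2
    rw [show n + K + 1 - 1 = n + K by omega] at h
    have hsq : Real.sqrt ((n : ℝ) + K + 1) ≤ Real.sqrt n + ((K : ℝ) + 1) := by
      rw [Real.sqrt_le_left (by positivity)]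
      nlinarith [Real.sq_sqrt (Nat.cast_nonneg n), Real.sqrt_nonneg (n : ℝ), sq_nonneg ((K:ℝ) + 1)]
    have hmul : c * Real.sqrt ((n : ℝ) + K + 1) ≤ c * (Real.sqrt n + ((K : ℝ) + 1)) :=
      mul_le_mul_of_nonneg_left hsq hc
    have hb := abs_le.1 h
    push_cast at hb
    have hKL : 0 ≤ ((K : ℝ) + 1) * logMuTri := by positivity
    show |Real.log (#(loopSL (n + K)) : ℝ) - n * logMuTri| ≤ _
    rw [abs_le]
    constructor
    · linarith [hb.1]
    · linarith [hb.2]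
  -- (ii) ratio floor `1/4`
  have hii : ∃ c' : ℝ, 0 < c' ∧ ∀ᶠ n in atTop, c' ≤ a (n + 1) / a n := by
    refine ⟨1 / 4, by norm_num, Eventually.of_forall fun n => ?_⟩
    have h := hM₀ (n + K) (by omega)
    rw [show n + K + 1 = n + 1 + K by omega] at h
    have h' : (#(loopSL (n + K)) : ℝ) ≤ 4 * #(loopSL (n + 1 + K)) := by exact_mod_cast h
    rw [le_div_iff₀ (hpos n)]
    simp only [ha]
    linarith
  -- (iii) Kesten (shifted; `D/(n+K) ≤ D⁺/n`)
  have hiii : ∃ D : ℝ, ∀ᶠ n : ℕ in atTop,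
      (a (n + 1) / a n) ^ 2 - D / n ≤ (a (n + 1) / a n) * (a (n + 2) / a (n + 1)) := by
    have hA : 0 < Real.exp c / Real.exp logMuTri := by positivity
    obtain ⟨D, hD⟩ := loopKesten_of detourDensityTri (M₀ := 3) hc hA (loopEnvelope_of_logEnvelope hc hEnv)
    refine ⟨max D 0, ?_⟩
    have hD' := (Filter.tendsto_add_atTop_nat K).eventually hD
    obtain ⟨n₀, hn₀⟩ := Filter.eventually_atTop.1 hD'
    refine Filter.eventually_atTop.2 ⟨max n₀ 1, fun n hn => ?_⟩
    have h := hn₀ n (le_trans (le_max_left _ _) hn)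
    have hn1 : (1 : ℝ) ≤ n := by exact_mod_cast le_trans (le_max_right _ _) hn
    have hfrac : D / ((n + K : ℕ) : ℝ) ≤ max D 0 / (n : ℝ) := by
      by_cases hD0 : 0 ≤ D
      · rw [max_eq_left hD0]
        apply div_le_div_of_nonneg_left hD0 (by positivity)
        push_cast; linarith
      · push Not at hD0
        have h1 : D / ((n + K : ℕ) : ℝ) ≤ 0 := div_nonpos_of_nonpos_of_nonneg hD0.le (by positivity)
        have h2 : (0 : ℝ) ≤ max D 0 / (n : ℝ) := div_nonneg (le_max_right _ _) (by positivity)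
        linarith
    have e1 : a (n + 1) = (#(loopSL (n + K + 1)) : ℝ) := by simp only [ha, show n + 1 + K = n + K + 1 by omega]
    have e2 : a (n + 2) = (#(loopSL (n + K + 2)) : ℝ) := by simp only [ha, show n + 2 + K = n + K + 2 by omega]
    rw [e1, e2]
    simp only [ha]
    linarith
  have hμ : 0 < Real.exp logMuTri := Real.exp_pos _
  have hK4 := Zd.tendsto_ratio_of_kesten_one hμ hpos hlim hii hiii
  -- un-shift
  rw [← Filter.tendsto_add_atTop_iff_nat K]
  refine hK4.congr' (Eventually.of_forall fun n => ?_)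
  simp only [ha, show n + 1 + K = n + K + 1 by omega]

/-! ### The faces of R82 in brick-frame tokens, modulo the R81 envelope -/

/-- **`TriLoopRatio` modulo `TriSAPEnvelope`**: `t_{N+1}/t_N → μ(𝕋)` for the rooted oriented polygon counts
`t N = #{ω ∈ brickSaws (N−1) : ω (N−1) ~ 0}`. [cite: MadrasSlade1993, Theorem 7.4.5 (c), p. 254; Lemma 7.3.1] -/
theorem triLoopRatio_of_logEnvelope
    (hEnv : ∀ N : ℕ, 4 ≤ N →
      (0 : ℝ) < #((brickSaws (N - 1)).filter fun ω => brickGraph.Adj (ω (N - 1)) 0) ∧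
      |Real.log (#((brickSaws (N - 1)).filter fun ω => brickGraph.Adj (ω (N - 1)) 0) : ℝ) - N * logMuTri| ≤
        (53 + 3 * logMuTri) * Real.sqrt N) :
    Tendsto (fun N : ℕ => (#((brickSaws (N + 1 - 1)).filter fun ω => brickGraph.Adj (ω (N + 1 - 1)) 0) : ℝ) /
      #((brickSaws (N - 1)).filter fun ω => brickGraph.Adj (ω (N - 1)) 0)) atTop (𝓝 (Real.exp logMuTri)) := by
  classical
  have hEnv' : ∀ N : ℕ, 4 ≤ N → (0 : ℝ) < #(loopSL (N - 1)) ∧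
      |Real.log (#(loopSL (N - 1)) : ℝ) - N * logMuTri| ≤ (53 + 3 * logMuTri) * Real.sqrt N := by
    intro N hN
    have h := hEnv N hN
    rwa [← card_loopSL] at h
  have h := tendsto_loop_ratio_of_logEnvelope hEnv'
  -- reindex `N = M + 1`
  rw [← Filter.tendsto_add_atTop_iff_nat 1]
  refine h.congr' (Eventually.of_forall fun M => ?_)
  simp only [show M + 1 + 1 - 1 = M + 1 by omega, show M + 1 - 1 = M by omega, card_loopSL]

/-- **`TriSAPRatio` modulo `TriSAPEnvelope`**: `q_{N+1}(𝕋)/q_N(𝕋) = N t_{N+1}/((N+1) t_N) → μ(𝕋)` — the one-step ratio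
limit theorem for self-avoiding polygons on the triangular lattice (counted per translation class, `t_N = 2N q_N`).
[cite: MadrasSlade1993, Theorem 7.4.5 (c), p. 254; eq. (3.2.1)] -/
theorem triSAPRatio_of_logEnvelope
    (hEnv : ∀ N : ℕ, 4 ≤ N →
      (0 : ℝ) < #((brickSaws (N - 1)).filter fun ω => brickGraph.Adj (ω (N - 1)) 0) ∧
      |Real.log (#((brickSaws (N - 1)).filter fun ω => brickGraph.Adj (ω (N - 1)) 0) : ℝ) - N * logMuTri| ≤
        (53 + 3 * logMuTri) * Real.sqrt N) :
    Tendsto (fun N : ℕ => (N : ℝ) * #((brickSaws (N + 1 - 1)).filter fun ω => brickGraph.Adj (ω (N + 1 - 1)) 0) /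
      (((N : ℝ) + 1) * #((brickSaws (N - 1)).filter fun ω => brickGraph.Adj (ω (N - 1)) 0)))
      atTop (𝓝 (Real.exp logMuTri)) := by
  have h := triLoopRatio_of_logEnvelope hEnv
  have hN : Tendsto (fun N : ℕ => (N : ℝ) / ((N : ℝ) + 1)) atTop (𝓝 1) := tendsto_natCast_div_add_atTop 1
  have := hN.mul h
  rw [one_mul] at this
  refine this.congr' (Eventually.of_forall fun N => ?_)
  exact div_mul_div_comm _ _ _ _

end Literature.Probability.RandomPlanarGeometry.SAW
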